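import Mathlib
import HarnessLib
import Summits.ValiantsHypothesis.ValiantsHypothesis.Theorems.MonotoneRestorationOrbitRestorationQPSmlInterpolation

/-!
# Narrow power-sum products lie in the span of the symmetric generating family
(crux `OrbitRestorationQP`, stmt-ValiantsHypothesis-18293 — lane SML: the column-set-multilinear `ΣΠΣ` stratum of A_∞)

F6c of the blueprint `SML-STRATUM-BLUEPRINT.md`.  For `w` slots, a grid point `τ : Fin w → Fin (n+1)` and the power sums
`p_k = Σ_a y_a^k` in `n` variables, consider the symmetric polynomials

  `Q τ = Σ_{a⃗ : Fin w → Fin n} (p_1 + Σ_i τ_i · y_{a⃗ i})^n`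

(the `x_{ab} ↦ y_a` images of the column-symmetric column-sml expressions `Σ_{a⃗} Π_b (C_b + Σ_i τ_i x_{(a⃗ i, b)})`).

* `Q_expansion` — `Q τ = Σ_{κ : Fin w → Fin (n+1)} τ^κ • V κ` with
  `V κ = N κ • p_1^{n - |κ|} Π_i p_{κ i}`, `N κ` = the number of words `ω : Fin n → Fin (w+1)` with letter profile `κ`
  (word expansion of the power, fibre-wise products, `Σ_{a⃗} Π_i y_{a⃗ i}^{k_i} = Π_i p_{k_i}`);
* `wordCount_pos` — `N κ ≥ 1` whenever `|κ| ≤ n` (a block word);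
* `psumProd_mem_span_Q` — hence `p_1^{n-|κ|} Π_i p_{κ i} ∈ span {Q τ}` for `|κ| ≤ n` (grid interpolation,
  `…SmlInterpolation.coeff_mem_span_gridValues`).
[folklore]
-/

set_option linter.dupNamespace false

namespace Summit.ValiantsHypothesis.ValiantsHypothesis.Theorems.SmlNarrowSpan

open MvPolynomial Finset SmlInterpolation

/-- A product over the letters of a word is the product over the alphabet of powers with the letter counts. [folklore] -/
theorem prod_word_eq_prod_pow {M : Type*} [CommMonoid M] {n L : ℕ} (z : Fin L → M) (ω : Fin n → Fin L) :
    ∏ m : Fin n, z (ω m) = ∏ l : Fin L, z l ^ (Finset.univ.filter fun m : Fin n => ω m = l).card := by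
  rw [← Finset.prod_fiberwise_of_maps_to (s := Finset.univ) (t := Finset.univ) (g := ω) (fun _ _ => Finset.mem_univ _)]
  refine Finset.prod_congr rfl fun l _ => ?_
  rw [Finset.prod_congr rfl (fun m hm => by rw [(Finset.mem_filter.1 hm).2]), Finset.prod_const]

/-- The letter counts of a word sum to its length. [folklore] -/
theorem sum_letterCount {n L : ℕ} (ω : Fin n → Fin L) :
    ∑ l : Fin L, (Finset.univ.filter fun m : Fin n => ω m = l).card = n := by
  rw [← Finset.card_eq_sum_card_fiberwise (fun _ _ => Finset.mem_univ _), Finset.card_univ, Fintype.card_fin]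

/-- `Σ_{a⃗} Π_i y_{a⃗ i}^{k i} = Π_i p_{k i}`. [folklore] -/
theorem sum_prod_X_pow_eq_prod_psum {n w : ℕ} (k : Fin w → ℕ) :
    ∑ g : Fin w → Fin n, ∏ i : Fin w, (X (g i) : MvPolynomial (Fin n) ℂ) ^ k i =
      ∏ i : Fin w, psum (Fin n) ℂ (k i) := by
  rw [← Fintype.prod_sum (fun i a => (X a : MvPolynomial (Fin n) ℂ) ^ k i)]
  rfl

/-- **Word expansion of the generating family.**
`Σ_{a⃗} (p_1 + Σ_i τ_i y_{a⃗ i})^n = Σ_κ τ^κ • (N κ • p_1^{n-|κ|} Π_i p_{κ i})`. [folklore] -/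
theorem Q_expansion (n w : ℕ) (τ : Fin w → Fin (n + 1)) :
    ∑ g : Fin w → Fin n, (psum (Fin n) ℂ 1 + ∑ i : Fin w, C (((τ i : ℕ) : ℂ)) * X (g i)) ^ n =
      ∑ κ : Fin w → Fin (n + 1), (∏ i, ((τ i : ℕ) : ℂ) ^ (κ i : ℕ)) •
        (((Finset.univ.filter fun ω : Fin n → Fin (w + 1) =>
            ∀ i : Fin w, (Finset.univ.filter fun m : Fin n => ω m = i.succ).card = (κ i : ℕ)).card : ℂ) •
          (psum (Fin n) ℂ 1 ^ (n - ∑ i, (κ i : ℕ)) * ∏ i, psum (Fin n) ℂ (κ i))) := by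
  classical
  -- the letter profile of a word, as a grid point
  let prof : (Fin n → Fin (w + 1)) → (Fin w → Fin (n + 1)) := fun ω i =>
    ⟨(Finset.univ.filter fun m : Fin n => ω m = i.succ).card,
      Nat.lt_succ_of_le ((Finset.card_filter_le _ _).trans (by simp))⟩
  have hprof : ∀ ω i, ((prof ω i : ℕ)) = (Finset.univ.filter fun m : Fin n => ω m = i.succ).card := fun _ _ => rfl
  -- expand each power as a sum over words, and evaluate the word products
  have hword : ∀ g : Fin w → Fin n,
      (psum (Fin n) ℂ 1 + ∑ i : Fin w, C (((τ i : ℕ) : ℂ)) * X (g i)) ^ n =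
        ∑ ω : Fin n → Fin (w + 1), psum (Fin n) ℂ 1 ^ (n - ∑ i, (prof ω i : ℕ)) *
          ((∏ i, C (((τ i : ℕ) : ℂ)) ^ (prof ω i : ℕ)) * ∏ i, X (g i) ^ (prof ω i : ℕ)) := by
    intro g
    have hcons : psum (Fin n) ℂ 1 + ∑ i : Fin w, C (((τ i : ℕ) : ℂ)) * X (g i) =
        ∑ l : Fin (w + 1), (Fin.cons (psum (Fin n) ℂ 1) (fun i => C (((τ i : ℕ) : ℂ)) * X (g i)) :
          Fin (w + 1) → MvPolynomial (Fin n) ℂ) l := by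
      rw [Fin.sum_univ_succ]; simp
    rw [hcons, Finset.sum_pow', Fintype.piFinset_univ]
    refine Finset.sum_congr rfl fun ω _ => ?_
    rw [prod_word_eq_prod_pow, Fin.prod_univ_succ]
    simp only [Fin.cons_zero, Fin.cons_succ, mul_pow, Finset.prod_mul_distrib]
    congr 1
    · congr 1
      have h := sum_letterCount ω
      rw [Fin.sum_univ_succ] at h
      simp only [hprof]
      omega
  simp_rw [hword]
  rw [Finset.sum_comm]
  -- sum over `g` inside: `Σ_g Π_i X (g i)^{k i} = Π_i p_{k i}`
  have hinner : ∀ ω : Fin n → Fin (w + 1),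
      ∑ g : Fin w → Fin n, psum (Fin n) ℂ 1 ^ (n - ∑ i, (prof ω i : ℕ)) *
          ((∏ i, C (((τ i : ℕ) : ℂ)) ^ (prof ω i : ℕ)) * ∏ i, X (g i) ^ (prof ω i : ℕ)) =
        (∏ i, ((τ i : ℕ) : ℂ) ^ (prof ω i : ℕ)) •
          (psum (Fin n) ℂ 1 ^ (n - ∑ i, (prof ω i : ℕ)) * ∏ i, psum (Fin n) ℂ (prof ω i : ℕ)) := by
    intro ω
    rw [← Finset.mul_sum, ← Finset.mul_sum, sum_prod_X_pow_eq_prod_psum, smul_eq_C_mul, map_prod]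
    simp only [map_pow]
    ring
  simp_rw [hinner]
  -- group the words by profile
  rw [← Finset.sum_fiberwise_of_maps_to (s := Finset.univ) (t := Finset.univ) (g := prof)
    (fun _ _ => Finset.mem_univ _)]
  refine Finset.sum_congr rfl fun κ _ => ?_
  have hfilter : (Finset.univ.filter fun ω : Fin n → Fin (w + 1) => prof ω = κ) =
      Finset.univ.filter fun ω : Fin n → Fin (w + 1) =>
        ∀ i : Fin w, (Finset.univ.filter fun m : Fin n => ω m = i.succ).card = (κ i : ℕ) := by
    ext ω
    simp only [Finset.mem_filter, Finset.mem_univ, true_and, funext_iff, Fin.ext_iff, hprof]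
  rw [Finset.sum_congr rfl (fun ω hω => by rw [(Finset.mem_filter.1 hω).2]), Finset.sum_const, hfilter, smul_comm,
    ← Nat.cast_smul_eq_nsmul ℂ]

/-- **A word with prescribed profile.**  If `Σ_i κ i ≤ n` there is a word `ω : Fin n → Fin (w+1)` using the letter
`i+1` exactly `κ i` times (the block word). [folklore] -/
theorem wordCount_pos (n w : ℕ) (κ : Fin w → Fin (n + 1)) (hκ : ∑ i, (κ i : ℕ) ≤ n) :
    0 < (Finset.univ.filter fun ω : Fin n → Fin (w + 1) =>
      ∀ i : Fin w, (Finset.univ.filter fun m : Fin n => ω m = i.succ).card = (κ i : ℕ)).card := by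
  classical
  rw [Finset.card_pos]
  -- partial sums `S i = Σ_{i' < i} κ i'`
  let S : ℕ → ℕ := fun i => ∑ i' ∈ Finset.range i, if h : i' < w then (κ ⟨i', h⟩ : ℕ) else 0
  have hS_succ : ∀ i : Fin w, S (i + 1) = S i + κ i := by
    intro i
    simp only [S, Finset.sum_range_succ, dif_pos i.isLt]
  have hS_mono : ∀ i i' : ℕ, i ≤ i' → S i ≤ S i' := by
    intro i i' h
    exact Finset.sum_le_sum_of_subset (Finset.range_subset_range.2 h)
  have hS_w : S w = ∑ i, (κ i : ℕ) := by
    simp only [S]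
    rw [← Fin.sum_univ_eq_sum_range (fun i' => if h : i' < w then (κ ⟨i', h⟩ : ℕ) else 0) w]
    exact Finset.sum_congr rfl fun i _ => by rw [dif_pos i.isLt]
  have hS_le : ∀ i : ℕ, i ≤ w → S i ≤ n := fun i hi => (hS_mono i w hi).trans (hS_w ▸ hκ)
  -- the block word: position `m` gets letter `i+1` iff `S i ≤ m < S (i+1)`, else `0`
  let ω : Fin n → Fin (w + 1) := fun m =>
    if h : ∃ i : Fin w, S i ≤ (m : ℕ) ∧ (m : ℕ) < S (i + 1) then (Classical.choose h).succ else 0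
  refine ⟨ω, Finset.mem_filter.2 ⟨Finset.mem_univ _, fun i => ?_⟩⟩
  -- uniqueness of the block containing `m`
  have huniq : ∀ (m : ℕ) (i i' : Fin w), S i ≤ m → m < S (i + 1) → S i' ≤ m → m < S (i' + 1) → i = i' := by
    intro m i i' h1 h2 h3 h4
    by_contra hne
    rcases lt_or_gt_of_ne (fun h : (i : ℕ) = i' => hne (Fin.ext h)) with hlt | hlt
    · have := hS_mono (i + 1) i' (by omega); omega
    · have := hS_mono (i' + 1) i (by omega); omega
  have hωval : ∀ m : Fin n, ω m = i.succ ↔ S i ≤ (m : ℕ) ∧ (m : ℕ) < S (i + 1) := by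
    intro m
    constructor
    · intro h
      simp only [ω] at h
      split_ifs at h with hex
      · have hspec := Classical.choose_spec hex
        rw [Fin.succ_inj] at h
        rw [← h]; exact hspec
      · exact absurd h.symm (Fin.succ_ne_zero _)
    · intro hm
      have hex : ∃ i : Fin w, S i ≤ (m : ℕ) ∧ (m : ℕ) < S (i + 1) := ⟨i, hm⟩
      simp only [ω, dif_pos hex, Fin.succ_inj]
      have hspec := Classical.choose_spec hex
      exact huniq m _ _ hspec.1 hspec.2 hm.1 hm.2
  -- count: the block `{m | S i ≤ m < S (i+1)}` has `κ i` elements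
  have hSi1 : S (i + 1) ≤ n := hS_le (i + 1) (by omega)
  have hcard : (Finset.univ.filter fun m : Fin n => ω m = i.succ).card = (Finset.Ico (S i) (S (i + 1))).card := by
    refine Finset.card_nbij (fun m : Fin n => (m : ℕ)) ?_ ?_ ?_
    · intro m hm
      rw [Finset.mem_coe, Finset.mem_filter, hωval] at hm
      exact Finset.mem_Ico.2 hm.2
    · intro m _ m' _ h
      exact Fin.ext h
    · intro x hx
      rw [Finset.mem_coe, Finset.mem_Ico] at hx
      refine ⟨⟨x, by omega⟩, ?_, rfl⟩
      rw [Finset.mem_coe, Finset.mem_filter, hωval]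
      exact ⟨Finset.mem_univ _, hx.1, hx.2⟩
  rw [hcard, Nat.card_Ico, hS_succ]
  omega

/-- **Narrow power-sum products are in the span of the generating family.**  For `|κ| ≤ n`:
`p_1^{n-|κ|} Π_i p_{κ i} ∈ span_ℂ {Q τ : τ ∈ {0..n}^w}`. [folklore] -/
theorem psumProd_mem_span_Q (n w : ℕ) (κ : Fin w → Fin (n + 1)) (hκ : ∑ i, (κ i : ℕ) ≤ n) :
    psum (Fin n) ℂ 1 ^ (n - ∑ i, (κ i : ℕ)) * ∏ i, psum (Fin n) ℂ (κ i) ∈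
      Submodule.span ℂ (Set.range fun τ : Fin w → Fin (n + 1) =>
        ∑ g : Fin w → Fin n, (psum (Fin n) ℂ 1 + ∑ i : Fin w, C (((τ i : ℕ) : ℂ)) * X (g i)) ^ n) := by
  classical
  have hV := coeff_mem_span_gridValues n w
    (fun κ : Fin w → Fin (n + 1) =>
      (((Finset.univ.filter fun ω : Fin n → Fin (w + 1) =>
          ∀ i : Fin w, (Finset.univ.filter fun m : Fin n => ω m = i.succ).card = (κ i : ℕ)).card : ℂ) •
        (psum (Fin n) ℂ 1 ^ (n - ∑ i, (κ i : ℕ)) * ∏ i, psum (Fin n) ℂ (κ i))))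
    (fun τ => ∑ g : Fin w → Fin n, (psum (Fin n) ℂ 1 + ∑ i : Fin w, C (((τ i : ℕ) : ℂ)) * X (g i)) ^ n)
    (fun τ => Q_expansion n w τ) κ
  have hN : (((Finset.univ.filter fun ω : Fin n → Fin (w + 1) =>
      ∀ i : Fin w, (Finset.univ.filter fun m : Fin n => ω m = i.succ).card = (κ i : ℕ)).card : ℂ)) ≠ 0 := by
    rw [Nat.cast_ne_zero]
    exact (wordCount_pos n w κ hκ).ne'
  have h := Submodule.smul_mem _ ((((Finset.univ.filter fun ω : Fin n → Fin (w + 1) =>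
      ∀ i : Fin w, (Finset.univ.filter fun m : Fin n => ω m = i.succ).card = (κ i : ℕ)).card : ℂ))⁻¹) hV
  rwa [smul_smul, inv_mul_cancel₀ hN, one_smul] at h

end Summit.ValiantsHypothesis.ValiantsHypothesis.Theorems.SmlNarrowSpan
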